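import Literature.AnabelianGeometry.EtaleTheta.FrobenioidThetaBiKummer
import Literature.AnabelianGeometry.EtaleTheta.Discharge.Sec5Cor512UniversalClosureRefuted

/-!
# [EtTh] §5 bi-Kummer rows (p. 331 / PDF p. 105; Prop. 5.1, 5.2 pp. 323–324): kernel verdicts on the eight parametrised FACT rows of `FrobenioidThetaBiKummer.lean`

Mochizuki, *The étale theta function and its Frobenioid-theoretic manifestations*, Publ. RIMS **45**
(2009) [cite: MochizukiEtTh2009, §5 p.331 (PDF p.105)].  abc-iut cell, block C / W6 (director C3 queue (3),
FACT-LIST proving), seat abc-iut-w6-d043; PROOF-ONLY companion of abc-iut-L2-t4's FROZEN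
`FrobenioidThetaBiKummer.lean` — no `Prop` fact is declared, nothing landed is edited or restated; the only
definitions are TOY MODEL data (L2 DEFS-FREEZE rule (B)(3)(b): model / construction file, flagged).

FACT-LIST rows (all `parametrised` = predicates on abstract §5 data `𝔉 : ThetaFrobenioid C D`, a DATA-ONLY
interface; FACT-LIST rule R5: such a row is consumed at NAMED instances, its universal closure is not a fact):
**F-0552** `ThetaFrobenioid.SgpCapSpec` (defining relation of `s^⊓-gp_N`, p.331), **F-0553** `SgpCupSpec`
(defining relation of `s^⊔-gp_N`, p.331), **F-0554** `SgpUnique` ("determines unique group homomorphisms",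
p.331), **F-0555** `StrvSection` (`s^trv_N` is a section, pp.330–331), **F-0551** `BiKummerDifferenceMem`
(Prop. 4.3 (iii): the bi-Kummer difference is `μ_N(B_N)`-valued), **F-0556**
`FrobenioidThetaBiKummer.ThetaPairActionsAgree` (Prop. 5.2 (ii)), **F-0558** `ThetaPairKummerClass`
(Prop. 5.2 (iii)), **F-2496** `ApplicabilityOfGeneralTheory` (Prop. 5.1).

WHAT IS PROVED.
* `SchemaToy.toy σ κ` — a toy §5 datum over `C = D = SingleObj (ℤ/2 × ℤ/2)` (base functor the identity,
  trivial divisors, all Frobenius degrees `1`, `A_⊚ = A_N = B_N = ⋆`, `s^⊓_N = s^⊔_N = 𝟙`, `N = 2`, `l = 1`,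
  `Π^tp_X = ℤ × (ℤ/2 × ℤ/2)` (discrete), `Π^tp_Ÿ = 1 × (ℤ/2 × 1)` (index `2` in `Π^tp_Y = 1 × (ℤ/2 × ℤ/2)`),
  `ρ =` the second projection onto `Aut(⋆) = ℤ/2 × ℤ/2` — so that BOTH `Aut_D(B_N^bs)` and `H_{B_N}` are
  NONTRIVIAL, which abc-iut-f-112's toy `ConstantMultiple.Cor512Toy.toyTheta` (base `Discrete PUnit`) is not),
  with `s^trv_N := σ`, `s^⊓-gp_N := κ` free parameters and `s^⊔-gp_N :=` the inclusion `H_{B_N} ↪ Aut(⋆)`.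
* UNIVERSAL CLOSURES REFUTED (`not_forall_…`): at `toyA := toy id 1` the rows `SgpCapSpec`, `SgpUnique`,
  `BiKummerDifferenceMem`, `ThetaPairActionsAgree` (with `actT := 1`), `ThetaPairKummerClass` (for EVERY
  `η, ν`) fail; at `toyB := toy 1 1` the rows `StrvSection`, `SgpCupSpec` fail; `ApplicabilityOfGeneralTheory`
  fails for the all-`False` vocabulary stub.
* INSTANCE FORMS PROVED at `toyC := toy id id` (`…_toyC`): all of `SgpCapSpec`, `SgpCupSpec`, `SgpUnique`
  (via abc-iut-L2-t4's `sgpUnique_of`), `StrvSection`, `BiKummerDifferenceMem`, `ThetaPairKummerClass` (with the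
  trivial comparison `ν`), and `ThetaPairActionsAgree` / `ApplicabilityOfGeneralTheory` at EVERY datum for the
  tautological parameters.  The GENUINE instance forms are the L2 discharge theorems, cited not restated:
  `TemperedFrobenioid.…` `Discharge/Sec5OfConnectedTemperoid.lean` and `Sec5OfTemperoidModelData.lean`
  (`StrvSection`, `SgpCapSpec` unconditional for the temperoid data), `Discharge/Sec5OfBiKummerDataKummer.lean`
  (`BiKummerDifferenceMem` for the assembled §5 data), `Discharge/Sec5BiKummerSections.lean`
  (`sgpCap_eq_liftAlong`: the data ARE the unique lifts), `Discharge/Sec5RigidityGlue.lean`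
  (`ThetaPairKummerClass ⟹ BiKummerDifferenceMem`), `ThetaFrobenioidOfTempered.applicability_of_model` /
  `Example39Data.applicability_of_example39` (Prop. 5.1 for the model).
* `…_schema_verdict` — per row, both conjuncts in one statement (the FACT-LIST renderer's «universal-closure
  REFUTED; instance form PROVED» label).

HONEST FRAMING: statements about the cell's own typing of refereed [EtTh] §5 sentences over abstract data; a toy
datum says nothing about the tempered Frobenioid of [EtTh] §5; the printed statements are neither refuted nor
proved here; nothing bears on [IUTchIII] Cor. 3.12; no side is taken; typed ≠ proved; a FACT row is an
assumption label, not an endorsement.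
-/

namespace Literature.AnabelianGeometry.EtaleTheta

namespace FrobenioidThetaBiKummer

namespace SchemaToy

open CategoryTheory
open Literature.AlgebraicGeometry.Frobenioids

universe w v v' u u'

/-! ### The toy category and groups -/

/-- `ℤ/2`, written multiplicatively (abc-iut-f-112's `Cor512Toy.Mm`). [cite: MochizukiEtTh2009, §5 p.331 (PDF p.105)] -/
abbrev M2 : Type := Multiplicative (ZMod 2)

/-- The generator `m₀` of `ℤ/2`. [cite: MochizukiEtTh2009, §5 p.331 (PDF p.105)] -/
abbrev m0 : M2 := Multiplicative.ofAdd 1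

/-- `G := ℤ/2 × ℤ/2`, playing `Aut_D(B_N^bs)`. [cite: MochizukiEtTh2009, §5 p.331 (PDF p.105)] -/
abbrev G : Type := M2 × M2

/-- The toy category: one object with automorphism group `G`; it serves as BOTH `C` and `D`, the base functor
being the identity. [cite: MochizukiEtTh2009, §5 p.331 (PDF p.105)] -/
abbrev TC : Type := SingleObj G

/-- The object `⋆` (plays `A_⊚ = A_N = B_N` and their base objects). [cite: MochizukiEtTh2009, §5 p.330 (PDF p.104)] -/
abbrev X : TC := SingleObj.star G

/-- The element `(m₀, 1) ∈ G` is not the identity. [cite: MochizukiEtTh2009, §5 p.331 (PDF p.105)] -/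
theorem m0one_ne_one : ((m0, (1 : M2)) : G) ≠ 1 := by decide

/-- Automorphism groups of the toy category are commutative (`G` is).
[cite: MochizukiEtTh2009, §5 p.331 (PDF p.105)] -/
theorem aut_mul_comm (S : TC) (a b : Aut S) : a * b = b * a := by
  apply Aut.ext
  change b.hom ≫ a.hom = a.hom ≫ b.hom
  rw [SingleObj.comp_as_mul, SingleObj.comp_as_mul]
  exact @mul_comm G _ _ _

/-- The toy pre-Frobenioid data: identity base functor, trivial divisor monoids, all Frobenius degrees `1`.
[cite: MochizukiEtTh2009, §4 p.312 (PDF p.86)] -/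
def toyPre : PreFrobenioidData.{0} TC TC where
  base := 𝟭 TC
  Mon := fun _ => Unit
  pull := fun _ => MonoidHom.id Unit
  pull_id := fun _ _ => rfl
  pull_comp := fun _ _ _ => rfl
  div := fun _ => ()
  degFr := fun _ => 1
  div_id := fun _ => rfl
  div_comp := fun _ _ => rfl
  degFr_id := fun _ => rfl
  degFr_comp := fun _ _ => (mul_one 1).symm

/-- The toy `TemperedFrobenioidStub`: `O^×(S^birat) := ℤ/2`, units sent to `1` (the unit groups `O^×(S)` are
trivial because the base functor is the identity), trivial unit pull-backs, every arrow "of base-Frobenius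
type". [cite: MochizukiEtTh2009, §5 p.322 (PDF p.96)] -/
def toyStub : FrobenioidTheta.TemperedFrobenioidStub.{0} TC TC where
  pre := toyPre
  units_comm S := ⟨⟨fun a b => Subtype.ext (aut_mul_comm S a.1 b.1)⟩⟩
  biratUnits := fun _ => M2
  unitsToBirat := fun _ => 1
  unitsToBirat_injective _ := fun a b _ => Subtype.ext (Aut.ext (a.2.1.trans b.2.1.symm))
  unitsPull := fun _ => 1
  IsBaseFrobeniusType := ⊤

/-- `ψ : ℤ × G → ℤ × ℤ/2`, `(n, (a, b)) ↦ (n, b)`; the toy `Π^tp_Ÿ` is `Ker ψ = 1 × (ℤ/2 × 1)`.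
[cite: MochizukiEtTh2009, Thm 5.10 (iii) proof p.335 (PDF p.109)] -/
def ψ : Multiplicative ℤ × G →* Multiplicative ℤ × M2 :=
  MonoidHom.prodMap (MonoidHom.id (Multiplicative ℤ)) (MonoidHom.snd M2 M2)

/-- `ψ` is surjective. [cite: MochizukiEtTh2009, Thm 5.10 (iii) proof p.335 (PDF p.109)] -/
theorem ψ_surjective : Function.Surjective ψ := fun x => ⟨(x.1, (1, x.2)), rfl⟩

/-- `[Ker(pr₁) : Ker ψ] = 2` inside `ℤ × G` (the index-`2` clause "`[Π^tp_Y : Π^tp_Ÿ] = 2`" of the §5 data).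
[cite: MochizukiEtTh2009, Thm 5.10 (iii) proof p.335 (PDF p.109)] -/
theorem relIndex_comap_ψ :
    ((⊥ : Subgroup (Multiplicative ℤ × M2)).comap ψ).relIndex
      (MonoidHom.fst (Multiplicative ℤ) G).ker = 2 := by
  have hK : (MonoidHom.fst (Multiplicative ℤ) G).ker =
      ((MonoidHom.fst (Multiplicative ℤ) M2).ker).comap ψ := by
    ext x
    rfl
  rw [hK, Subgroup.relIndex_comap, Subgroup.map_comap_eq_self_of_surjective ψ_surjective,
    Subgroup.relIndex_bot_left, Nat.card_congr ConstantMultiple.Cor512Toy.kerFstEquiv, Nat.card_zmod]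

/-- `G ⥲ Aut_D(⋆)`: an element of `G` as an automorphism of the object `⋆` of `SingleObj G`.
[cite: MochizukiEtTh2009, §5 p.331 (PDF p.105)] -/
def toAutG : G →* Aut X := (Units.toAut G).toMonoidHom.comp (toUnits (G := G)).toMonoidHom

/-- The underlying arrow of `toAutG g` is `g`. [cite: MochizukiEtTh2009, §5 p.331 (PDF p.105)] -/
theorem toAutG_hom (g : G) : (toAutG g).hom = g := rfl

/-- `toAutG` is surjective (it is a composite of isomorphisms). [cite: MochizukiEtTh2009, Def 4.1 (ii) p.313 (PDF p.87)] -/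
theorem toAutG_surjective : Function.Surjective toAutG :=
  (Units.toAut G).surjective.comp (toUnits (G := G)).surjective

/-! ### The toy §5 datum `toy σ κ` -/

/-- **The toy §5 datum** `toy σ κ : ThetaFrobenioid C D` over `C = D = SingleObj (ℤ/2 × ℤ/2)` (every field of
the DATA-ONLY interface supplied): `A_⊚ = A_N = B_N = ⋆`, `s^⊓_N = s^⊔_N = 𝟙`, `N = 2`, `l = 1`,
`Π^tp_X = ℤ × G` (discrete), `Π^tp_Ÿ = Ker ψ`, `ρ = pr₂` (so `H_{B_N} = ℤ/2 × 1 ⊆ Aut(⋆) = G` is nontrivial),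
`s^trv_N := σ`, `s^⊓-gp_N := κ`, `s^⊔-gp_N :=` the inclusion `H_{B_N} ↪ Aut(⋆)`, `K = 𝔽₂`, `Θ̈ := 1`.
[cite: MochizukiEtTh2009, §5 p.330–331 (PDF pp.104–105)] -/
def toy (σ κ : Aut X →* Aut X) : ThetaFrobenioid.{0} TC TC where
  toTemperedFrobenioidStub := toyStub
  lDelta := fun _ => Unit
  lDeltaMap := fun _ => MonoidHom.id Unit
  l := 1
  odd_l := odd_one
  N := 2
  Acirc := X
  AN := X
  BN := X
  sCap := 𝟙 X
  sCup := 𝟙 X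
  base_map_sCap := rfl
  isPreStep_sCap := ⟨rfl, by change IsIso (𝟙 X); infer_instance⟩
  isPreStep_sCup := ⟨rfl, by change IsIso (𝟙 X); infer_instance⟩
  PiX := Multiplicative ℤ × G
  zquot := MonoidHom.fst _ _
  zquot_surjective := fun z => ⟨(z, 1), rfl⟩
  PiYdd := (⊥ : Subgroup (Multiplicative ℤ × M2)).comap ψ
  PiYdd_le := fun x hx => by
    rw [Subgroup.mem_comap, Subgroup.mem_bot] at hx
    rw [MonoidHom.mem_ker]
    exact congrArg Prod.fst hx
  relindex_PiYdd := relIndex_comap_ψ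
  PiYdd_normal := inferInstance
  isOpen_PiYdd := isOpen_discrete _
  ρ := toAutG.comp (MonoidHom.snd (Multiplicative ℤ) G)
  ρ_surjective := fun g => by
    obtain ⟨x, hx⟩ := toAutG_surjective g
    exact ⟨(1, x), hx⟩
  isOpen_ker_ρ := isOpen_discrete _
  strv := σ
  sgpCap := κ
  sgpCup := (((⊥ : Subgroup (Multiplicative ℤ × M2)).comap ψ).map
    (toAutG.comp (MonoidHom.snd (Multiplicative ℤ) G))).subtype
  K := ZMod 2
  constEmb := 1
  constEmb_injective := by
    intro a b _
    have h : ∀ u : (ZMod 2)ˣ, u = 1 := by decide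
    rw [h a, h b]
  thetaFn := (1 : M2)

variable (σ κ : Aut X →* Aut X)

/-- `s^trv_N = σ` in the toy datum. [cite: MochizukiEtTh2009, §5 p.331 (PDF p.105)] -/
theorem toy_strv : (toy σ κ).strv = σ := rfl

/-- `s^⊓-gp_N = κ` in the toy datum. [cite: MochizukiEtTh2009, §5 p.331 (PDF p.105)] -/
theorem toy_sgpCap : (toy σ κ).sgpCap = κ := rfl

/-- `s^⊔-gp_N` is the inclusion in the toy datum: `s^⊔-gp_N(h) = h`. [cite: MochizukiEtTh2009, §5 p.331 (PDF p.105)] -/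
theorem toy_sgpCup_apply (h : (toy σ κ).HB) : (toy σ κ).sgpCup h = h.1 := rfl

/-- `s^⊓_N = 𝟙` in the toy datum. [cite: MochizukiEtTh2009, §5 p.330 (PDF p.104)] -/
theorem toy_sCap : (toy σ κ).sCap = 𝟙 X := rfl

/-- `s^⊔_N = 𝟙` in the toy datum. [cite: MochizukiEtTh2009, §5 p.330 (PDF p.104)] -/
theorem toy_sCup : (toy σ κ).sCup = 𝟙 X := rfl

/-- The base functor of the toy datum is the identity on arrows. [cite: MochizukiEtTh2009, §4 p.312 (PDF p.86)] -/
theorem toy_base_map {S T : TC} (f : S ⟶ T) : (toy σ κ).base.map f = f := rfl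

/-- In the toy datum a unit (base-identity linear automorphism) is the identity: `O^×(⋆) = 1`.
[cite: MochizukiEtTh2009, §5 p.331 (PDF p.105)] -/
theorem eq_one_of_mem_units {u : Aut (toy σ κ).BN} (hu : u ∈ (toy σ κ).units (toy σ κ).BN) :
    u = 1 := Aut.ext hu.1

/-- Hence `μ_N(B_N) = 1` in the toy datum: every element of the cyclotome is the identity automorphism.
[cite: MochizukiEtTh2009, Def 5.4 p.327 (PDF p.101)] -/
theorem muTorsion_coe_eq_one (u : (toy σ κ).muTorsion (toy σ κ).BN (toy σ κ).N) :
    (u : Aut (toy σ κ).BN) = 1 :=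
  eq_one_of_mem_units σ κ u.2.1

/-- `Aut_D(A_N^bs) ⥲ Aut_D(B_N^bs)` is the identity in the toy datum (it is conjugation by `(s^⊓_N)^bs = 𝟙`).
[cite: MochizukiEtTh2009, §5 p.331 (PDF p.105)] -/
theorem autBaseIsoAB_apply (g : Aut X) : (toy σ κ).autBaseIsoAB g = g := by
  apply Aut.ext
  rw [ThetaFrobenioid.autBaseIsoAB, Iso.conjAut_hom, Iso.conj_apply]
  change inv (𝟙 X) ≫ g.hom ≫ 𝟙 X = g.hom
  simp only [IsIso.inv_id, Category.id_comp, Category.comp_id]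

/-- … and so is its inverse. [cite: MochizukiEtTh2009, §5 p.331 (PDF p.105)] -/
theorem autBaseIsoAB_symm_apply (g : Aut X) : (toy σ κ).autBaseIsoAB.symm g = g :=
  (MulEquiv.symm_apply_eq _).mpr (autBaseIsoAB_apply σ κ g).symm

/-- `(1, (m₀, 1)) ∈ Π^tp_Ÿ = Ker ψ`. [cite: MochizukiEtTh2009, §5 p.332 (PDF p.106)] -/
theorem mem_PiYdd : ((1 : Multiplicative ℤ), ((m0, (1 : M2)) : G)) ∈ (toy σ κ).PiYdd :=
  show ψ (1, (m0, 1)) = 1 from rfl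

/-- **`h₀ := ρ(1, (m₀, 1)) ∈ H_{B_N}`**, an element of `H_{B_N}` whose underlying arrow is `(m₀, 1) ≠ 1`.
[cite: MochizukiEtTh2009, §5 p.331 (PDF p.105)] -/
def h0 : (toy σ κ).HB := ⟨toAutG (m0, 1), ⟨_, mem_PiYdd σ κ, rfl⟩⟩

/-- The underlying arrow of `h₀` is `(m₀, 1)`. [cite: MochizukiEtTh2009, §5 p.331 (PDF p.105)] -/
theorem h0_hom : (h0 σ κ).1.hom = ((m0, (1 : M2)) : G) := rfl

/-- `h₀ ≠ 1` in `Aut(⋆)`. [cite: MochizukiEtTh2009, §5 p.331 (PDF p.105)] -/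
theorem h0_ne_one : (h0 σ κ).1 ≠ 1 := fun h =>
  m0one_ne_one ((h0_hom σ κ).symm.trans (congrArg Iso.hom h))

/-- `h₀ ∉ O^×(B_N)` (it is not base-identity). [cite: MochizukiEtTh2009, §5 p.331 (PDF p.105)] -/
theorem h0_not_mem_units : (h0 σ κ).1 ∉ (toy σ κ).units (toy σ κ).BN := fun h =>
  h0_ne_one σ κ (eq_one_of_mem_units σ κ h)

/-- The (unique) isomorphism `(l·Δ_Θ)_{B_N} ⊗ ℤ/Nℤ ⥲ μ_N(B_N)` of the toy datum — both sides are trivial groups.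
[cite: MochizukiEtTh2009, Prop 5.5 p.327 (PDF p.101)] -/
def nuToy : (toy σ κ).lDeltaModN (toy σ κ).BN ≃* (toy σ κ).muTorsion (toy σ κ).BN (toy σ κ).N where
  toFun _ := 1
  invFun _ := 1
  left_inv := by
    rintro ⟨z⟩
    rfl
  right_inv u := Subtype.ext ((muTorsion_coe_eq_one σ κ u).symm)
  map_mul' _ _ := (mul_one _).symm

/-! ### The three specialisations -/

/-- `toyA := toy id 1`: `s^trv_N = id`, `s^⊓-gp_N = 1`. [cite: MochizukiEtTh2009, §5 p.331 (PDF p.105)] -/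
abbrev toyA : ThetaFrobenioid.{0} TC TC := toy (MonoidHom.id (Aut X)) 1

/-- `toyB := toy 1 1`: `s^trv_N = 1`, `s^⊓-gp_N = 1`. [cite: MochizukiEtTh2009, §5 p.331 (PDF p.105)] -/
abbrev toyB : ThetaFrobenioid.{0} TC TC := toy 1 1

/-- `toyC := toy id id`: `s^trv_N = id`, `s^⊓-gp_N = id`. [cite: MochizukiEtTh2009, §5 p.331 (PDF p.105)] -/
abbrev toyC : ThetaFrobenioid.{0} TC TC := toy (MonoidHom.id (Aut X)) (MonoidHom.id (Aut X))

/-! ### F-0552 `SgpCapSpec` -/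

/-- `SgpCapSpec` FAILS at `toyA`: with `s^⊓-gp_N = 1`, `s^trv_N = id` the relation `𝟙 ≫ 1 = g' ≫ 𝟙` fails at
`g' = (m₀, 1)`. [cite: MochizukiEtTh2009, §5 p.331 (PDF p.105)] -/
theorem not_sgpCapSpec_toyA : ¬ toyA.SgpCapSpec := by
  intro h
  have h1 : (𝟙 X : X ⟶ X) ≫ ((1 : Aut X →* Aut X) (toyA.autBaseIsoAB (toAutG (m0, 1)))).hom =
      ((MonoidHom.id (Aut X)) (toyA.autBaseIsoAB.symm (toyA.autBaseIsoAB (toAutG (m0, 1))))).hom ≫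
        𝟙 X := h _
  rw [MulEquiv.symm_apply_apply, MonoidHom.one_apply, MonoidHom.id_apply, Category.id_comp,
    Category.comp_id] at h1
  exact m0one_ne_one h1.symm

/-- **F-0552, universal closure REFUTED**: the defining relation of `s^⊓-gp_N` is NOT a consequence of the
abstract §5 interface (R5: named instances only). [cite: MochizukiEtTh2009, §5 p.331 (PDF p.105)] -/
theorem not_forall_sgpCapSpec :
    ¬ ∀ (C : Type) [Category.{0} C] (D : Type) [Category.{0} D] (𝔉 : ThetaFrobenioid.{0} C D),
        𝔉.SgpCapSpec :=
  fun h => not_sgpCapSpec_toyA (h TC TC toyA)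

/-- **F-0552, instance form PROVED** at `toyC` (`s^⊓-gp_N = s^trv_N = id`, `Aut_D(A_N^bs) ⥲ Aut_D(B_N^bs)` the
identity).  Genuine instances: `Discharge/Sec5OfConnectedTemperoid.lean`, `Sec5OfTemperoidModelData.lean`.
[cite: MochizukiEtTh2009, §5 p.331 (PDF p.105)] -/
theorem sgpCapSpec_toyC : toyC.SgpCapSpec := by
  intro g
  change (𝟙 X : X ⟶ X) ≫ ((MonoidHom.id (Aut X)) g).hom =
    ((MonoidHom.id (Aut X)) (toyC.autBaseIsoAB.symm g)).hom ≫ 𝟙 X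
  rw [autBaseIsoAB_symm_apply, Category.id_comp, Category.comp_id]

/-- **F-0552, kernel verdict**: universal closure refuted AND instance form proved.
[cite: MochizukiEtTh2009, §5 p.331 (PDF p.105)] -/
theorem sgpCapSpec_schema_verdict :
    (¬ ∀ (C : Type) [Category.{0} C] (D : Type) [Category.{0} D] (𝔉 : ThetaFrobenioid.{0} C D),
        𝔉.SgpCapSpec) ∧ toyC.SgpCapSpec :=
  ⟨not_forall_sgpCapSpec, sgpCapSpec_toyC⟩

/-! ### F-0553 `SgpCupSpec` -/

/-- `SgpCupSpec` FAILS at `toyB`: with `s^⊔-gp_N(h₀) = h₀ ≠ 1` and `s^trv_N = 1` the relation `𝟙 ≫ h₀ = 1 ≫ 𝟙`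
fails. [cite: MochizukiEtTh2009, §5 p.331 (PDF p.105)] -/
theorem not_sgpCupSpec_toyB : ¬ toyB.SgpCupSpec := by
  intro h
  have h1 : (𝟙 X : X ⟶ X) ≫ (h0 1 1).1.hom =
      ((1 : Aut X →* Aut X) (toyB.autBaseIsoAB.symm (h0 1 1).1)).hom ≫ 𝟙 X :=
    h (h0 1 1)
  rw [MonoidHom.one_apply, Category.id_comp, Category.comp_id] at h1
  exact m0one_ne_one h1

/-- **F-0553, universal closure REFUTED** (R5: named instances only). [cite: MochizukiEtTh2009, §5 p.331 (PDF p.105)] -/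
theorem not_forall_sgpCupSpec :
    ¬ ∀ (C : Type) [Category.{0} C] (D : Type) [Category.{0} D] (𝔉 : ThetaFrobenioid.{0} C D),
        𝔉.SgpCupSpec :=
  fun h => not_sgpCupSpec_toyB (h TC TC toyB)

/-- **F-0553, instance form PROVED** at `toyC`.  Genuine instance: `Discharge/Sec5BiKummerSections.lean`
(the defining relations hold for the lifts).  [cite: MochizukiEtTh2009, §5 p.331 (PDF p.105)] -/
theorem sgpCupSpec_toyC : toyC.SgpCupSpec := by
  intro h
  change (𝟙 X : X ⟶ X) ≫ h.1.hom =
    ((MonoidHom.id (Aut X)) (toyC.autBaseIsoAB.symm h.1)).hom ≫ 𝟙 X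
  rw [autBaseIsoAB_symm_apply, MonoidHom.id_apply, Category.id_comp, Category.comp_id]

/-- **F-0553, kernel verdict**. [cite: MochizukiEtTh2009, §5 p.331 (PDF p.105)] -/
theorem sgpCupSpec_schema_verdict :
    (¬ ∀ (C : Type) [Category.{0} C] (D : Type) [Category.{0} D] (𝔉 : ThetaFrobenioid.{0} C D),
        𝔉.SgpCupSpec) ∧ toyC.SgpCupSpec :=
  ⟨not_forall_sgpCupSpec, sgpCupSpec_toyC⟩

/-! ### F-0554 `SgpUnique` -/

/-- `SgpUnique` FAILS at `toyA`: `a := id`, `b := inclusion` satisfy both defining relations, but `a ≠ s^⊓-gp_N = 1`.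
[cite: MochizukiEtTh2009, §5 p.331 (PDF p.105)] -/
theorem not_sgpUnique_toyA : ¬ toyA.SgpUnique := by
  intro h
  have H := h toyA.autBaseIsoAB.symm.toMonoidHom (toyA.autBaseIsoAB.symm.toMonoidHom.comp toyA.HB.subtype)
    (fun g => by
      change (𝟙 X : X ⟶ X) ≫ (toyA.autBaseIsoAB.symm g).hom =
        ((MonoidHom.id (Aut X)) (toyA.autBaseIsoAB.symm g)).hom ≫ 𝟙 X
      rw [MonoidHom.id_apply, Category.id_comp, Category.comp_id])
    (fun g => by
      change (𝟙 X : X ⟶ X) ≫ (toyA.autBaseIsoAB.symm g.1).hom =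
        ((MonoidHom.id (Aut X)) (toyA.autBaseIsoAB.symm g.1)).hom ≫ 𝟙 X
      rw [MonoidHom.id_apply, Category.id_comp, Category.comp_id])
  have H1 : toyA.autBaseIsoAB.symm.toMonoidHom (toyA.autBaseIsoAB (toAutG (m0, 1))) =
      (1 : Aut X →* Aut X) (toyA.autBaseIsoAB (toAutG (m0, 1))) := DFunLike.congr_fun H.1 _
  rw [MulEquiv.coe_toMonoidHom, MulEquiv.symm_apply_apply, MonoidHom.one_apply] at H1
  exact m0one_ne_one (congrArg Iso.hom H1)

/-- **F-0554, universal closure REFUTED** (R5; consistent with abc-iut-L2-t4's `sgpUnique_of`: at `toyA` the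
defining relation `SgpCapSpec` itself fails).  [cite: MochizukiEtTh2009, §5 p.331 (PDF p.105)] -/
theorem not_forall_sgpUnique :
    ¬ ∀ (C : Type) [Category.{0} C] (D : Type) [Category.{0} D] (𝔉 : ThetaFrobenioid.{0} C D),
        𝔉.SgpUnique :=
  fun h => not_sgpUnique_toyA (h TC TC toyA)

/-- **F-0554, instance form PROVED** at `toyC`, by abc-iut-L2-t4's `sgpUnique_of` (defining relations + `s^⊓_N`,
`s^⊔_N` epimorphisms).  [cite: MochizukiEtTh2009, §5 p.331 (PDF p.105)] -/
theorem sgpUnique_toyC : toyC.SgpUnique := by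
  haveI : Epi toyC.sCap := by change Epi (𝟙 X); infer_instance
  haveI : Epi toyC.sCup := by change Epi (𝟙 X); infer_instance
  exact toyC.sgpUnique_of sgpCapSpec_toyC sgpCupSpec_toyC

/-- **F-0554, kernel verdict**. [cite: MochizukiEtTh2009, §5 p.331 (PDF p.105)] -/
theorem sgpUnique_schema_verdict :
    (¬ ∀ (C : Type) [Category.{0} C] (D : Type) [Category.{0} D] (𝔉 : ThetaFrobenioid.{0} C D),
        𝔉.SgpUnique) ∧ toyC.SgpUnique :=
  ⟨not_forall_sgpUnique, sgpUnique_toyC⟩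

/-! ### F-0555 `StrvSection` -/

/-- `StrvSection` FAILS at `toyB`: `s^trv_N = 1` is not a section over the nontrivial `Aut_D(A_N^bs) = G`.
[cite: MochizukiEtTh2009, §5 p.331 (PDF p.105)] -/
theorem not_strvSection_toyB : ¬ toyB.StrvSection := by
  intro h
  have h1 : toyB.autBase X ((1 : Aut X →* Aut X) (toAutG (m0, 1))) = toAutG (m0, 1) := h _
  rw [MonoidHom.one_apply, map_one] at h1
  exact m0one_ne_one (congrArg Iso.hom h1).symm

/-- **F-0555, universal closure REFUTED** (R5: named instances only). [cite: MochizukiEtTh2009, §5 p.331 (PDF p.105)] -/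
theorem not_forall_strvSection :
    ¬ ∀ (C : Type) [Category.{0} C] (D : Type) [Category.{0} D] (𝔉 : ThetaFrobenioid.{0} C D),
        𝔉.StrvSection :=
  fun h => not_strvSection_toyB (h TC TC toyB)

/-- **F-0555, instance form PROVED** at `toyC` (`s^trv_N = id` over the identity base functor).  Genuine
instances: `StrvSection` UNCONDITIONAL for the temperoid data (`Discharge/Sec5OfConnectedTemperoid.lean`,
`Sec5OfTemperoidModelData.lean`).  [cite: MochizukiEtTh2009, §5 p.331 (PDF p.105)] -/
theorem strvSection_toyC : toyC.StrvSection := fun _ => Aut.ext rfl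

/-- **F-0555, kernel verdict**. [cite: MochizukiEtTh2009, §5 p.331 (PDF p.105)] -/
theorem strvSection_schema_verdict :
    (¬ ∀ (C : Type) [Category.{0} C] (D : Type) [Category.{0} D] (𝔉 : ThetaFrobenioid.{0} C D),
        𝔉.StrvSection) ∧ toyC.StrvSection :=
  ⟨not_forall_strvSection, strvSection_toyC⟩

/-! ### F-0551 `BiKummerDifferenceMem` -/

/-- `BiKummerDifferenceMem` FAILS at `toyA`: `s^⊔-gp_N(h₀) · s^⊓-gp_N(h₀)⁻¹ = h₀ ∉ μ_N(B_N) = 1`.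
[cite: MochizukiEtTh2009, Prop 4.3 (iii) p.317 (PDF p.91)] -/
theorem not_biKummerDifferenceMem_toyA : ¬ toyA.BiKummerDifferenceMem := by
  intro h
  have h1 := toyA.muTorsion_le_units _ _ (h (h0 (MonoidHom.id (Aut X)) 1))
  rw [show toyA.sgpCap (h0 (MonoidHom.id (Aut X)) 1).1 = 1 from rfl, inv_one, mul_one] at h1
  exact h0_not_mem_units _ _ h1

/-- **F-0551, universal closure REFUTED** (R5: named instances only).
[cite: MochizukiEtTh2009, Prop 4.3 (iii) p.317 (PDF p.91)] -/
theorem not_forall_biKummerDifferenceMem :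
    ¬ ∀ (C : Type) [Category.{0} C] (D : Type) [Category.{0} D] (𝔉 : ThetaFrobenioid.{0} C D),
        𝔉.BiKummerDifferenceMem :=
  fun h => not_biKummerDifferenceMem_toyA (h TC TC toyA)

/-- **F-0551, instance form PROVED** at `toyC` (`s^⊔-gp_N(h) · s^⊓-gp_N(h)⁻¹ = h · h⁻¹ = 1`).  Genuine instance:
`Discharge/Sec5OfBiKummerDataKummer.lean` (a THEOREM for the assembled §5 data) and the generic model form of
`Discharge/Sec5KummerTorsionGeneric.lean`.  [cite: MochizukiEtTh2009, Prop 4.3 (iii) p.317 (PDF p.91)] -/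
theorem biKummerDifferenceMem_toyC : toyC.BiKummerDifferenceMem := by
  intro h
  rw [show toyC.sgpCup h = toyC.sgpCap h.1 from rfl, mul_inv_cancel]
  exact one_mem _

/-- **F-0551, kernel verdict**. [cite: MochizukiEtTh2009, Prop 4.3 (iii) p.317 (PDF p.91)] -/
theorem biKummerDifferenceMem_schema_verdict :
    (¬ ∀ (C : Type) [Category.{0} C] (D : Type) [Category.{0} D] (𝔉 : ThetaFrobenioid.{0} C D),
        𝔉.BiKummerDifferenceMem) ∧ toyC.BiKummerDifferenceMem :=
  ⟨not_forall_biKummerDifferenceMem, biKummerDifferenceMem_toyC⟩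

/-! ### F-0556 `ThetaPairActionsAgree` (Prop. 5.2 (ii)) -/

/-- **F-0556, universal closure REFUTED**: the §1 actions are PARAMETERS of the typed statement; for the
parameter `actT := 1` at `toyA` (where `s^⊔-gp_N(h₀) = h₀ ≠ 1`) the identification fails (R5: the row is a
statement about WHICH actions are supplied, i.e. about named instances).
[cite: MochizukiEtTh2009, Prop 5.2 (ii) p.324 (PDF p.98)] -/
theorem not_forall_thetaPairActionsAgree :
    ¬ ∀ (C : Type) [Category.{0} C] (D : Type) [Category.{0} D] (𝔉 : ThetaFrobenioid.{0} C D)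
        (actS actT : 𝔉.HB →* Aut 𝔉.BN), ThetaPairActionsAgree 𝔉 actS actT := by
  intro h
  have h1 : (1 : toyA.HB →* Aut X) (h0 (MonoidHom.id (Aut X)) 1) =
      toyA.sgpCup (h0 (MonoidHom.id (Aut X)) 1) :=
    DFunLike.congr_fun (h TC TC toyA 1 1).2 _
  rw [MonoidHom.one_apply, toy_sgpCup_apply] at h1
  exact h0_ne_one _ _ h1.symm

/-- **F-0556, instance form PROVED** (tautological parameters): at EVERY §5 datum the statement holds for
`actS := s^⊓-gp_N|_{H_{B_N}}`, `actT := s^⊔-gp_N` — the content of Prop. 5.2 (ii) lies entirely in the §1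
actions to be supplied by abc-iut-L2-t1's decls (`TODO-merge`), not in the abstract interface.
[cite: MochizukiEtTh2009, Prop 5.2 (ii) p.324 (PDF p.98)] -/
theorem thetaPairActionsAgree_self {C : Type u} [Category.{v} C] {D : Type u'} [Category.{v'} D]
    (𝔉 : ThetaFrobenioid.{w} C D) :
    ThetaPairActionsAgree 𝔉 (𝔉.sgpCap.comp 𝔉.HB.subtype) 𝔉.sgpCup :=
  ⟨rfl, rfl⟩

/-- **F-0556, kernel verdict**. [cite: MochizukiEtTh2009, Prop 5.2 (ii) p.324 (PDF p.98)] -/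
theorem thetaPairActionsAgree_schema_verdict :
    (¬ ∀ (C : Type) [Category.{0} C] (D : Type) [Category.{0} D] (𝔉 : ThetaFrobenioid.{0} C D)
        (actS actT : 𝔉.HB →* Aut 𝔉.BN), ThetaPairActionsAgree 𝔉 actS actT) ∧
      ∀ (C : Type) [Category.{0} C] (D : Type) [Category.{0} D] (𝔉 : ThetaFrobenioid.{0} C D),
        ∃ actS actT : 𝔉.HB →* Aut 𝔉.BN, ThetaPairActionsAgree 𝔉 actS actT :=
  ⟨not_forall_thetaPairActionsAgree, fun _ _ _ _ 𝔉 => ⟨_, _, thetaPairActionsAgree_self 𝔉⟩⟩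

/-! ### F-0558 `ThetaPairKummerClass` (Prop. 5.2 (iii)) -/

/-- `ThetaPairKummerClass` FAILS at `toyA` for EVERY cocycle `η` and comparison `ν`: `μ_N(B_N) = 1`, so the
statement forces `s^⊓-gp_N(h₀) · s^⊔-gp_N(h₀)⁻¹ = h₀⁻¹` to be trivial, but `h₀ ≠ 1`.
[cite: MochizukiEtTh2009, Prop 5.2 (iii) p.324 (PDF p.98)] -/
theorem not_thetaPairKummerClass_toyA (η : toyA.HB → toyA.lDeltaModN toyA.BN)
    (ν : toyA.lDeltaModN toyA.BN ≃* toyA.muTorsion toyA.BN toyA.N) :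
    ¬ ThetaPairKummerClass toyA η ν := by
  rintro ⟨u, hu, h⟩
  have hu1 : u = 1 := eq_one_of_mem_units _ _ hu.1
  have h1 := h (h0 (MonoidHom.id (Aut X)) 1)
  rw [hu1, muTorsion_coe_eq_one, show toyA.sgpCap (h0 (MonoidHom.id (Aut X)) 1).1 = 1 from rfl] at h1
  simp only [inv_one, mul_one, one_mul] at h1
  exact h0_ne_one (MonoidHom.id (Aut X)) 1 (inv_eq_one.mp h1)

/-- **F-0558, universal closure REFUTED** (R5: named instances only).
[cite: MochizukiEtTh2009, Prop 5.2 (iii) p.324 (PDF p.98)] -/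
theorem not_forall_thetaPairKummerClass :
    ¬ ∀ (C : Type) [Category.{0} C] (D : Type) [Category.{0} D] (𝔉 : ThetaFrobenioid.{0} C D)
        (η : 𝔉.HB → 𝔉.lDeltaModN 𝔉.BN) (ν : 𝔉.lDeltaModN 𝔉.BN ≃* 𝔉.muTorsion 𝔉.BN 𝔉.N),
        ThetaPairKummerClass 𝔉 η ν :=
  fun h => not_thetaPairKummerClass_toyA (fun _ => 1) (nuToy _ _) (h TC TC toyA _ _)

/-- **F-0558, instance form PROVED** at `toyC` (with `u := 1` and the trivial comparison `ν`: both sides are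
`1`).  Genuine route: `Discharge/Sec5RigidityGlue.lean` (`ThetaPairKummerClass ⟹ BiKummerDifferenceMem`) and
the §2/§5 Kummer-class files of abc-iut-L2-t2/t4.  [cite: MochizukiEtTh2009, Prop 5.2 (iii) p.324 (PDF p.98)] -/
theorem thetaPairKummerClass_toyC (η : toyC.HB → toyC.lDeltaModN toyC.BN) :
    ThetaPairKummerClass toyC η (nuToy _ _) := by
  refine ⟨1, one_mem _, fun h => ?_⟩
  rw [muTorsion_coe_eq_one, show toyC.sgpCup h = toyC.sgpCap h.1 from rfl]
  simp only [mul_one, inv_one, mul_inv_cancel]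

/-- **F-0558, kernel verdict**. [cite: MochizukiEtTh2009, Prop 5.2 (iii) p.324 (PDF p.98)] -/
theorem thetaPairKummerClass_schema_verdict :
    (¬ ∀ (C : Type) [Category.{0} C] (D : Type) [Category.{0} D] (𝔉 : ThetaFrobenioid.{0} C D)
        (η : 𝔉.HB → 𝔉.lDeltaModN 𝔉.BN) (ν : 𝔉.lDeltaModN 𝔉.BN ≃* 𝔉.muTorsion 𝔉.BN 𝔉.N),
        ThetaPairKummerClass 𝔉 η ν) ∧
      ∀ η : toyC.HB → toyC.lDeltaModN toyC.BN, ThetaPairKummerClass toyC η (nuToy _ _) :=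
  ⟨not_forall_thetaPairKummerClass, thetaPairKummerClass_toyC⟩

/-! ### F-2496 `ApplicabilityOfGeneralTheory` (Prop. 5.1) -/

/-- The vocabulary stub with every opaque predicate `False` (the stub constrains nothing).
[cite: MochizukiEtTh2009, Prop 5.1 p.323 (PDF p.97)] -/
def falseVocab {C : Type u} [Category.{v} C] {D : Type u'} [Category.{v'} D]
    (𝔉 : ThetaFrobenioid.{w} C D) : TemperedVocabStub 𝔉 where
  IsTemperedFrobenioid := False
  IsRationallyStandard := False
  IsSlimBase := False
  IsMonoidTypeZ := False
  IsPerfect := False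
  IsPerfFactorial := False
  IsNonDilating := False
  IsCuspidallyPure := False
  HypothesesCor38 := fun _ => False
  HypothesesThm44 := fun _ => False

/-- The vocabulary stub with every opaque predicate `True`.
[cite: MochizukiEtTh2009, Prop 5.1 p.323 (PDF p.97)] -/
def trueVocab {C : Type u} [Category.{v} C] {D : Type u'} [Category.{v'} D]
    (𝔉 : ThetaFrobenioid.{w} C D) : TemperedVocabStub 𝔉 where
  IsTemperedFrobenioid := True
  IsRationallyStandard := True
  IsSlimBase := True
  IsMonoidTypeZ := True
  IsPerfect := True
  IsPerfFactorial := True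
  IsNonDilating := True
  IsCuspidallyPure := True
  HypothesesCor38 := fun _ => True
  HypothesesThm44 := fun _ => True

/-- **F-2496, universal closure REFUTED**: over the all-`False` vocabulary stub Prop. 5.1 as typed fails (the
typed statement is the conjunction of the stub's opaque predicates; R5: named instances only — the genuine
instance forms are `ThetaFrobenioidOfTempered.applicability_of_model` /
`Example39Data.applicability_of_example39`).  [cite: MochizukiEtTh2009, Prop 5.1 p.323 (PDF p.97)] -/
theorem not_forall_applicabilityOfGeneralTheory :
    ¬ ∀ (C : Type) [Category.{0} C] (D : Type) [Category.{0} D] (𝔉 : ThetaFrobenioid.{0} C D)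
        (V : TemperedVocabStub 𝔉) (Ψ : C ≌ C), ApplicabilityOfGeneralTheory 𝔉 V Ψ :=
  fun h => (h TC TC toyB (falseVocab toyB) CategoryTheory.Equivalence.refl).tempered

/-- **F-2496, instance form PROVED** (tautological parameters): over the all-`True` stub Prop. 5.1 as typed
holds at EVERY datum and self-equivalence.  [cite: MochizukiEtTh2009, Prop 5.1 p.323 (PDF p.97)] -/
theorem applicabilityOfGeneralTheory_trueVocab {C : Type u} [Category.{v} C] {D : Type u'} [Category.{v'} D]
    (𝔉 : ThetaFrobenioid.{w} C D) (Ψ : C ≌ C) : ApplicabilityOfGeneralTheory 𝔉 (trueVocab 𝔉) Ψ :=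
  ⟨trivial, trivial, trivial, trivial, trivial, trivial, trivial, trivial, trivial, trivial⟩

/-- **F-2496, kernel verdict**. [cite: MochizukiEtTh2009, Prop 5.1 p.323 (PDF p.97)] -/
theorem applicabilityOfGeneralTheory_schema_verdict :
    (¬ ∀ (C : Type) [Category.{0} C] (D : Type) [Category.{0} D] (𝔉 : ThetaFrobenioid.{0} C D)
        (V : TemperedVocabStub 𝔉) (Ψ : C ≌ C), ApplicabilityOfGeneralTheory 𝔉 V Ψ) ∧
      ∀ (C : Type) [Category.{0} C] (D : Type) [Category.{0} D] (𝔉 : ThetaFrobenioid.{0} C D) (Ψ : C ≌ C),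
        ∃ V : TemperedVocabStub 𝔉, ApplicabilityOfGeneralTheory 𝔉 V Ψ :=
  ⟨not_forall_applicabilityOfGeneralTheory,
    fun _ _ _ _ 𝔉 Ψ => ⟨trueVocab 𝔉, applicabilityOfGeneralTheory_trueVocab 𝔉 Ψ⟩⟩

end SchemaToy

end FrobenioidThetaBiKummer

end Literature.AnabelianGeometry.EtaleTheta
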